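import Summits.AtomisticToContinuum.Crystallization.Theses.PalmUnimodularRigidity
import Summits.AtomisticToContinuum.Crystallization.Theorems.MinimiserShells.Negative.LoadBearing
import Summits.AtomisticToContinuum.Crystallization.Theorems.MinimiserShells.Negative.Rootedness
import Literature.Probability.Process.PointStationaryLaw
import Literature.MathematicalPhysics.StatisticalMechanics.RootEnergy
import Literature.MathematicalPhysics.StatisticalMechanics.MuGSC

/-!
# An s-finite regularisation of the identity kernel on configurations, and its powers

Helper file for stub `stub_equilibriumInLaw` (S1) of line `equilibrium-in-law-surgery`, crux
`MinimiserShells` (stmt-AtomisticToContinuum-9225): blueprint lemma 8a–8b (measurability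
infrastructure, reusable by every Mecke computation whose transport reads the configuration
through integrals `∫ f(μ, ·) dμ`).

Joint measurability of `(μ, x) ↦ ∫ f (x, z) dμ(z)` on `Measure E3 × X` is available in Mathlib
for s-finite KERNELS (`Measurable.lintegral_kernel_prod_right`), not for the raw evaluation
`μ ↦ μ` (which is not an s-finite kernel: it hits non-s-finite measures).  We regularise:

* `shell N = {z | N ≤ ‖z‖ < N + 1}` — a measurable partition of `ℝ³`;
* `piece (N, n) μ = pieceWeight (N, n) μ • μ|shell N`, `pieceWeight = 1[n < μ(shell N) ≤ n + 1]` —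
  a FINITE kernel (mass `≤ n + 1`);
* `lfKernel = Kernel.sum piece` — an s-finite kernel `Measure E3 →ₖ E3` with
  `lfKernel μ = μ` whenever every shell has finite mass (`lfKernel_apply`), in particular for
  the counting measure of a separated set (`lfKernel_count_restrict`);
* `piKernel n : Kernel (Measure E3) (Fin n → E3)` — the `n`-th power (`lfKernel ⊗ … ⊗ lfKernel`,
  built recursively with `Kernel.prod` and `Fin.cons`), s-finite, with the Tonelli recursion
  `lintegral_piKernel_succ` and, for counting measures of countable sets, the support statement
  `lintegral_piKernel_eq_zero_iff` (`∫ G d(piKernel n count|S) = 0 ↔ G = 0` on `S^n`).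
-/

noncomputable section

open MeasureTheory ProbabilityTheory
open scoped ENNReal BigOperators

namespace Summit.AtomisticToContinuum.Crystallization.Theorems.PalmUnimodularRigidityMinimiserShells.EquilibriumInLaw.LfKernel

open Literature.Probability.Process (IsPointStationaryLaw IsRootedHardCore count_restrict_singleton_ne_zero_iff
  map_sub_count_restrict)
open Literature.MathematicalPhysics.StatisticalMechanics (lennardJones IsMuGSC UniformlyDiscrete)
open Summit.AtomisticToContinuum.Crystallization.Theses.PalmUnimodularRigidity (MinimiserShells UnimodularEnergyLowerBound)
open Summit.AtomisticToContinuum.Crystallization.Theorems.MinimiserShells.Negative.LoadBearing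
  (eStar meanRootEnergy GoodShell minimiserShells_iff)
open Summit.AtomisticToContinuum.Crystallization.Theorems.MinimiserShells.Negative.Rootedness (E3
  countable_of_separated)

/-! ## Shells -/

/-- The `N`-th unit shell `{z | N ≤ ‖z‖ < N + 1}` of `ℝ³`. -/
def shell (N : ℕ) : Set E3 := {z | (N : ℝ) ≤ ‖z‖ ∧ ‖z‖ < N + 1}

/-- Shells are measurable. -/
theorem measurableSet_shell (N : ℕ) : MeasurableSet (shell N) :=
  (measurableSet_le measurable_const measurable_norm).inter
    (measurableSet_lt measurable_norm measurable_const)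

/-- The shell containing `z` is the one of index `⌊‖z‖⌋₊`. -/
theorem mem_shell_iff (N : ℕ) (z : E3) : z ∈ shell N ↔ ⌊‖z‖⌋₊ = N := by
  rw [shell, Set.mem_setOf_eq, Nat.floor_eq_iff (norm_nonneg z)]

/-- Shells are pairwise disjoint. -/
theorem pairwise_disjoint_shell : Pairwise (Function.onFun Disjoint shell) := by
  intro N M hNM
  refine Set.disjoint_left.2 fun z hzN hzM => hNM ?_
  rw [mem_shell_iff] at hzN hzM
  exact hzN.symm.trans hzM

/-- Shells cover `ℝ³`. -/
theorem iUnion_shell : ⋃ N, shell N = Set.univ :=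
  Set.eq_univ_of_forall fun z => Set.mem_iUnion.2 ⟨⌊‖z‖⌋₊, (mem_shell_iff _ z).2 rfl⟩

/-- Shells are bounded. -/
theorem shell_subset_closedBall (N : ℕ) : shell N ⊆ Metric.closedBall (0 : E3) (N + 1) :=
  fun z hz => by rw [Metric.mem_closedBall, dist_zero_right]; exact hz.2.le

/-! ## The regularised identity kernel -/

/-- The weight of the `(N, n)`-th piece: `1` if `n < μ(shell N) ≤ n + 1`, else `0`. -/
def pieceWeight (p : ℕ × ℕ) (μ : Measure E3) : ℝ≥0∞ :=
  if (p.2 : ℝ≥0∞) < μ (shell p.1) ∧ μ (shell p.1) ≤ p.2 + 1 then 1 else 0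

/-- The weights are measurable in the configuration. -/
theorem measurable_pieceWeight (p : ℕ × ℕ) : Measurable (pieceWeight p) := by
  unfold pieceWeight
  refine Measurable.ite ?_ measurable_const measurable_const
  exact (measurableSet_lt measurable_const (Measure.measurable_coe (measurableSet_shell p.1))).inter
    (measurableSet_le (Measure.measurable_coe (measurableSet_shell p.1)) measurable_const)

/-- The `(N, n)`-th piece: `μ|shell N` if `n < μ(shell N) ≤ n + 1`, else `0`. -/
def piece (p : ℕ × ℕ) : Kernel (Measure E3) E3 where
  toFun μ := pieceWeight p μ • μ.restrict (shell p.1)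
  measurable' := by
    refine Measure.measurable_of_measurable_coe _ fun s hs => ?_
    simp only [Measure.smul_apply, Measure.restrict_apply hs, smul_eq_mul]
    exact (measurable_pieceWeight p).mul (Measure.measurable_coe (hs.inter (measurableSet_shell _)))

/-- Evaluation of a piece. -/
theorem piece_apply (p : ℕ × ℕ) (μ : Measure E3) {s : Set E3} (hs : MeasurableSet s) :
    piece p μ s = pieceWeight p μ * μ (s ∩ shell p.1) := by
  change (pieceWeight p μ • μ.restrict (shell p.1)) s = _
  rw [Measure.smul_apply, Measure.restrict_apply hs, smul_eq_mul]

/-- Each piece is a finite kernel (mass `≤ n + 1`). -/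
instance isFiniteKernel_piece (p : ℕ × ℕ) : IsFiniteKernel (piece p) := by
  refine ⟨⟨(p.2 : ℝ≥0∞) + 1, by simp, fun μ => ?_⟩⟩
  rw [piece_apply p μ MeasurableSet.univ, Set.univ_inter]
  by_cases h : (p.2 : ℝ≥0∞) < μ (shell p.1) ∧ μ (shell p.1) ≤ p.2 + 1
  · rw [pieceWeight, if_pos h, one_mul]
    exact h.2
  · rw [pieceWeight, if_neg h, zero_mul]
    exact bot_le

/-- **The regularised identity kernel** `lfKernel = ∑_{N, n} piece (N, n)`: an s-finite kernel
from configurations to points which is the identity on locally finite measures. -/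
def lfKernel : Kernel (Measure E3) E3 :=
  Kernel.sum piece

/-- `lfKernel` is s-finite (a countable sum of finite kernels). -/
instance isSFiniteKernel_lfKernel : IsSFiniteKernel lfKernel := by
  unfold lfKernel
  infer_instance

/-- On one shell of finite mass exactly one piece fires: `∑_n piece (N, n) μ s = μ (s ∩ shell N)`. -/
theorem tsum_piece_apply (N : ℕ) (μ : Measure E3) (hN : μ (shell N) ≠ ∞) {s : Set E3}
    (hs : MeasurableSet s) : ∑' n : ℕ, piece (N, n) μ s = μ (s ∩ shell N) := by
  simp only [piece_apply _ μ hs]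
  rcases eq_or_ne (μ (shell N)) 0 with h0 | h0
  · have hs0 : μ (s ∩ shell N) = 0 := measure_mono_null Set.inter_subset_right h0
    simp [hs0, pieceWeight, h0]
  · -- the unique `n₀` with `n₀ < μ(shell N) ≤ n₀ + 1`
    have hex : ∃ n : ℕ, μ (shell N) ≤ (n : ℝ≥0∞) + 1 := by
      obtain ⟨n, hn⟩ := ENNReal.exists_nat_gt hN
      exact ⟨n, hn.le.trans (by simp)⟩
    classical
    set n₀ := Nat.find hex with hn₀
    have hle : μ (shell N) ≤ (n₀ : ℝ≥0∞) + 1 := Nat.find_spec hex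
    have hlt : (n₀ : ℝ≥0∞) < μ (shell N) := by
      rcases Nat.eq_zero_or_pos n₀ with hz | hpos
      · rw [hz, Nat.cast_zero]
        exact pos_iff_ne_zero.2 h0
      · have hmin := Nat.find_min hex (show n₀ - 1 < n₀ by omega)
        rw [not_le] at hmin
        have hcast : ((n₀ - 1 : ℕ) : ℝ≥0∞) + 1 = n₀ := by
          rw [← Nat.cast_succ, Nat.succ_eq_add_one, Nat.sub_add_cancel hpos]
        rwa [hcast] at hmin
    have huniq : ∀ n : ℕ, (n : ℝ≥0∞) < μ (shell N) → μ (shell N) ≤ (n : ℝ≥0∞) + 1 → n = n₀ := by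
      intro n hn1 hn2
      have h1 : (n : ℝ≥0∞) < (n₀ : ℝ≥0∞) + 1 := hn1.trans_le hle
      have h2 : (n₀ : ℝ≥0∞) < (n : ℝ≥0∞) + 1 := hlt.trans_le hn2
      rw [← Nat.cast_succ, Nat.cast_lt] at h1 h2
      omega
    rw [tsum_eq_single n₀]
    · rw [pieceWeight, if_pos ⟨hlt, hle⟩, one_mul]
    · intro n hn
      rw [pieceWeight, if_neg, zero_mul]
      rintro ⟨h1, h2⟩
      exact hn (huniq n h1 h2)

/-- **`lfKernel` is the identity on locally finite measures**: if every shell has finite mass,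
`lfKernel μ = μ`. -/
theorem lfKernel_apply {μ : Measure E3} (h : ∀ N, μ (shell N) ≠ ∞) : lfKernel μ = μ := by
  rw [lfKernel, Kernel.sum_apply]
  ext s hs
  rw [Measure.sum_apply _ hs, ENNReal.tsum_prod']
  simp_rw [tsum_piece_apply _ μ (h _) hs]
  have hdisj : Pairwise (Function.onFun Disjoint fun N => s ∩ shell N) := fun N M hNM =>
    Disjoint.mono Set.inter_subset_right Set.inter_subset_right (pairwise_disjoint_shell hNM)
  rw [← measure_iUnion hdisj fun N => hs.inter (measurableSet_shell N), ← Set.inter_iUnion,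
    iUnion_shell, Set.inter_univ]

/-- The counting measure of a separated set of `ℝ³` gives finite mass to every shell. -/
theorem count_restrict_shell_ne_top {δ : ℝ} (hδ : 0 < δ) {S : Set E3}
    (hsep : ∀ x ∈ S, ∀ y ∈ S, x ≠ y → δ ≤ dist x y) (N : ℕ) :
    (Measure.count : Measure E3).restrict S (shell N) ≠ ∞ := by
  have hud : UniformlyDiscrete S := ⟨δ, hδ, hsep⟩
  have hfin : (S ∩ Metric.closedBall (0 : E3) (N + 1)).Finite := hud.finite_inter_closedBall 0 _
  rw [Measure.restrict_apply (measurableSet_shell N), Set.inter_comm]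
  refine ne_top_of_le_ne_top ?_ (measure_mono (Set.inter_subset_inter_right S (shell_subset_closedBall N)))
  rw [Measure.count_apply_finite _ hfin]
  exact ENNReal.natCast_ne_top _

/-- `lfKernel` is the identity on counting measures of separated sets. -/
theorem lfKernel_count_restrict {δ : ℝ} (hδ : 0 < δ) {S : Set E3}
    (hsep : ∀ x ∈ S, ∀ y ∈ S, x ≠ y → δ ≤ dist x y) :
    lfKernel ((Measure.count : Measure E3).restrict S) = (Measure.count : Measure E3).restrict S :=
  lfKernel_apply (count_restrict_shell_ne_top hδ hsep)

/-! ## Counting measures of countable sets -/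

/-- Integration against the counting measure of a countable set is the sum over the set. -/
theorem lintegral_count_restrict {S : Set E3} (hS : S.Countable) (f : E3 → ℝ≥0∞) :
    ∫⁻ z, f z ∂(Measure.count : Measure E3).restrict S = ∑' z : S, f z := by
  rw [lintegral_countable _ hS]
  simp

/-! ## Powers of the kernel -/

/-- `Fin.cons` as a map `E3 × (Fin n → E3) → (Fin (n + 1) → E3)`. -/
def consMap (n : ℕ) (p : E3 × (Fin n → E3)) : Fin (n + 1) → E3 := Fin.cons p.1 p.2

/-- `consMap` is measurable. -/
theorem measurable_consMap (n : ℕ) : Measurable (consMap n) := by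
  refine measurable_pi_iff.2 fun i => ?_
  refine Fin.cases ?_ (fun j => ?_) i
  · simpa [consMap] using measurable_fst
  · simp only [consMap, Fin.cons_succ]
    exact (measurable_pi_apply j).comp measurable_snd

/-- **Powers of `lfKernel`**: `piKernel n μ` is (for locally finite `μ`) the product measure
`μ^{⊗ n}` on `Fin n → E3`, built recursively from `Kernel.prod` and `Fin.cons`. -/
def piKernel : (n : ℕ) → Kernel (Measure E3) (Fin n → E3)
  | 0 => Kernel.const _ (Measure.dirac finZeroElim)
  | n + 1 => Kernel.map (lfKernel ×ₖ piKernel n) (consMap n)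

/-- The powers are s-finite kernels. -/
instance isSFiniteKernel_piKernel : ∀ n, IsSFiniteKernel (piKernel n)
  | 0 => by rw [piKernel]; infer_instance
  | n + 1 => by
    haveI := isSFiniteKernel_piKernel n
    rw [piKernel]; infer_instance

/-- The zeroth power is the Dirac mass at the empty configuration. -/
theorem lintegral_piKernel_zero (μ : Measure E3) (G : (Fin 0 → E3) → ℝ≥0∞) :
    ∫⁻ x, G x ∂(piKernel 0 μ) = G finZeroElim := by
  rw [piKernel, Kernel.const_apply, lintegral_dirac]

/-- **Tonelli recursion** for the powers: if `lfKernel μ = μ`,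
`∫ G d(piKernel (n+1) μ) = ∫ (∫ G (Fin.cons a x) d(piKernel n μ)(x)) dμ(a)`. -/
theorem lintegral_piKernel_succ {μ : Measure E3} (hμ : lfKernel μ = μ) (n : ℕ)
    {G : (Fin (n + 1) → E3) → ℝ≥0∞} (hG : Measurable G) :
    ∫⁻ x, G x ∂(piKernel (n + 1) μ) = ∫⁻ a, ∫⁻ x, G (Fin.cons a x) ∂(piKernel n μ) ∂μ := by
  rw [piKernel, Kernel.map_apply _ (measurable_consMap n), Kernel.prod_apply, hμ,
    lintegral_map hG (measurable_consMap n)]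
  exact lintegral_prod (fun z => G (consMap n z)) (hG.comp (measurable_consMap n)).aemeasurable

/-- **Support of the powers on counting measures.** For the counting measure of a countable set
`S` (with `lfKernel count|S = count|S`) and measurable `G ≥ 0`:
`∫ G d(piKernel n count|S) = 0 ↔ G(x) = 0` for every `x ∈ S^n`. -/
theorem lintegral_piKernel_eq_zero_iff {S : Set E3} (hS : S.Countable)
    (hμ : lfKernel ((Measure.count : Measure E3).restrict S) = (Measure.count : Measure E3).restrict S) :
    ∀ (n : ℕ) {G : (Fin n → E3) → ℝ≥0∞}, Measurable G →
      (∫⁻ x, G x ∂(piKernel n ((Measure.count : Measure E3).restrict S)) = 0 ↔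
        ∀ x : Fin n → E3, (∀ i, x i ∈ S) → G x = 0)
  | 0, G, _ => by
    rw [lintegral_piKernel_zero]
    constructor
    · intro h x _
      rwa [Subsingleton.elim x finZeroElim]
    · intro h
      exact h _ fun i => i.elim0
  | n + 1, G, hG => by
    have hGa : ∀ a : E3, Measurable fun x : Fin n → E3 => G (Fin.cons a x) := fun a =>
      hG.comp ((measurable_consMap n).comp (measurable_const.prodMk measurable_id))
    rw [lintegral_piKernel_succ hμ n hG, lintegral_count_restrict hS, ENNReal.tsum_eq_zero]
    constructor
    · intro h x hx
      have h1 : ∫⁻ x', G (Fin.cons (x 0) x')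
          ∂(piKernel n ((Measure.count : Measure E3).restrict S)) = 0 := h ⟨x 0, hx 0⟩
      rw [lintegral_piKernel_eq_zero_iff hS hμ n (hGa (x 0))] at h1
      have := h1 (Fin.tail x) fun i => hx i.succ
      rwa [Fin.cons_self_tail] at this
    · intro h a
      rw [lintegral_piKernel_eq_zero_iff hS hμ n (hGa a)]
      intro x hx
      refine h (Fin.cons (a : E3) x) fun i => ?_
      refine Fin.cases ?_ (fun j => ?_) i
      · simp
      · simpa using hx j

/-- Registered stub marker (helper part 6/14 of `stub_equilibriumInLaw`, line `equilibrium-in-law-surgery`):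
the s-finite regularised identity kernel is the identity on locally finite measures, `lfKernel_apply`, closed form. -/
theorem stub_equilibriumInLaw_part06 :
    ∀ μ : Measure (EuclideanSpace ℝ (Fin 3)), (∀ N, μ (shell N) ≠ ∞) → lfKernel μ = μ :=
  fun _ h => lfKernel_apply h

end Summit.AtomisticToContinuum.Crystallization.Theorems.PalmUnimodularRigidityMinimiserShells.EquilibriumInLaw.LfKernel

end
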